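import Summits.RiemannHypothesis.RiemannHypothesis.Theorems.SignConeConeMagnificationLandau
import Mathlib.NumberTheory.SumPrimeReciprocals
import Mathlib.Data.Nat.Factorization.PrimePow

/-!
# `SignCone.ConeMagnification`, line `Sketch`: the registered stub `stub_transfer` (Landau transfer)
(crux stmt-RiemannHypothesis-16303; HELPER file, `--supports`, proves the stub BY NAME AND SIGNATURE)

`stub_transfer` of the crux skeleton `Cruxes/ConeMagnification/Lines/Sketch.lean` is the Landau transfer:
`c ≥ 0`, `Σ c(n) n^{-σ} < ∞` (`σ > 1`), local continuation of `L_c(s) - 1/(s-1)` to thin rectangles through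
every point of `Re s > 1/2` reaching `Re s > 1`, and `Σ_p (log p - c(p))₊ p^{-σ} < ∞` (`σ > 1/2`) ⟹ RH. It is
proved here from the tree's `riemannHypothesis_of_fakeWeight_landau` (`SignConeConeMagnificationLandau.lean`),
whose hypotheses are repackaged:

* `summable_vonMangoldt_nonprime_rpow` — `Σ_{n not prime} Λ(n) n^{-σ} < ∞` for `σ > 1/2` (the higher prime
  powers `p^k`, `k ≥ 2`: `log p · p^{-kσ}` over `Nat.Primes × ℕ`, as in Mathlib's
  `ArithmeticFunction.vonMangoldt.summable_residueClass_non_primes_div`, exponent generalized);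
* `lseriesSummable_posPart_of_prime_deficit` — hence the PRIME deficit bound of the stub gives the full one-sided
  series `Σ_n (Λ(n) - c(n))₊ n^{-σ} < ∞` used by the Landau file (`(Λ - c)₊ ≤ Λ` off the primes);
* `stub_transfer` — the stub, verbatim: the stub's rectangles through `s₀ = max X 1 + iγ` contain the Landau
  file's rectangles `(1/2, X) × (γ - η, γ + η)`, and `Σ c(n) n^{-2} < ∞` is the absolute convergence it needs.
-/

noncomputable section

-- `Summit.RiemannHypothesis.RiemannHypothesis.…` repeats a namespace component by design (D-0017 layout).
set_option linter.dupNamespace false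

open scoped ArithmeticFunction.vonMangoldt
open Complex Set Filter LSeries

namespace Summit.RiemannHypothesis.RiemannHypothesis.Cruxes.ConeMagnification.Sketch

open Literature.NumberTheory.LFunctions
open Summit.RiemannHypothesis.RiemannHypothesis.Theorems.SignCone

/-! ## Higher prime powers: `Σ_{n not prime} Λ(n) n^{-σ} < ∞` for `σ > 1/2` -/

/-- The shifted family `(p, k) ↦ log p · (p^{k+2})^{-σ}` is summable over `Nat.Primes × ℕ` for `σ > 1/2`:
`log p ≤ p^ε/ε` (`ε = σ - 1/2`) bounds it by `ε⁻¹ p^{-(1+ε)} (p^{-σ})^k`, geometric in `k` with ratio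
`≤ 2^{-σ} < 1`, and `Σ_p p^{-(1+ε)} < ∞` (`Nat.Primes.summable_rpow`). [folklore] -/
theorem summable_log_mul_rpow_pow {σ : ℝ} (hσ : 1 / 2 < σ) :
    Summable fun pk : Nat.Primes × ℕ => Real.log pk.1 * ((pk.1 : ℝ) ^ (-σ)) ^ (pk.2 + 2) := by
  set ε : ℝ := σ - 1 / 2 with hε
  have hεp : 0 < ε := by linarith
  have hσ0 : 0 < σ := by linarith
  have hp0 : ∀ p : Nat.Primes, (0 : ℝ) < p := fun p => by exact_mod_cast p.prop.pos
  have hr0 : ∀ p : Nat.Primes, 0 ≤ (p : ℝ) ^ (-σ) := fun p => Real.rpow_nonneg (hp0 p).le _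
  have h2σ : (2 : ℝ) ^ (-σ) < 1 := Real.rpow_lt_one_of_one_lt_of_neg (by norm_num) (by linarith)
  have hrle : ∀ p : Nat.Primes, (p : ℝ) ^ (-σ) ≤ (2 : ℝ) ^ (-σ) := fun p =>
    Real.rpow_le_rpow_of_nonpos (by norm_num) (by exact_mod_cast p.prop.two_le) (by linarith)
  have hr1 : ∀ p : Nat.Primes, (p : ℝ) ^ (-σ) < 1 := fun p => (hrle p).trans_lt h2σ
  -- the majorant `B (p, k) = ε⁻¹ p^{-(1+ε)} r_p^k`
  set B : Nat.Primes × ℕ → ℝ := fun pk => ε⁻¹ * (pk.1 : ℝ) ^ (-(1 + ε)) * ((pk.1 : ℝ) ^ (-σ)) ^ pk.2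
    with hB
  have hBs : Summable B := by
    refine (summable_prod_of_nonneg fun pk => by positivity).mpr ⟨fun p => ?_, ?_⟩
    · simp only [hB]
      exact (summable_geometric_of_lt_one (hr0 p) (hr1 p)).mul_left (ε⁻¹ * (p : ℝ) ^ (-(1 + ε)))
    · have htsum : ∀ p : Nat.Primes, ∑' k, B (p, k) =
          ε⁻¹ * (p : ℝ) ^ (-(1 + ε)) * (1 - (p : ℝ) ^ (-σ))⁻¹ := fun p => by
        simp only [hB]
        rw [tsum_mul_left, tsum_geometric_of_lt_one (hr0 p) (hr1 p)]
      simp_rw [htsum]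
      have hmaj : Summable fun p : Nat.Primes => ε⁻¹ * (1 - (2 : ℝ) ^ (-σ))⁻¹ * (p : ℝ) ^ (-(1 + ε)) :=
        ((Nat.Primes.summable_rpow.mpr (by linarith : -(1 + ε) < -1)).mul_left _)
      refine hmaj.of_nonneg_of_le (fun p => ?_) (fun p => ?_)
      · have : 0 < 1 - (p : ℝ) ^ (-σ) := by linarith [hr1 p]
        positivity
      · have h1 : (1 - (p : ℝ) ^ (-σ))⁻¹ ≤ (1 - (2 : ℝ) ^ (-σ))⁻¹ :=
          inv_anti₀ (by linarith) (by linarith [hrle p])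
        calc ε⁻¹ * (p : ℝ) ^ (-(1 + ε)) * (1 - (p : ℝ) ^ (-σ))⁻¹
            ≤ ε⁻¹ * (p : ℝ) ^ (-(1 + ε)) * (1 - (2 : ℝ) ^ (-σ))⁻¹ :=
              mul_le_mul_of_nonneg_left h1 (by positivity)
          _ = ε⁻¹ * (1 - (2 : ℝ) ^ (-σ))⁻¹ * (p : ℝ) ^ (-(1 + ε)) := by ring
  refine hBs.of_nonneg_of_le (fun pk => ?_) (fun pk => ?_)
  · exact mul_nonneg (Real.log_nonneg (by exact_mod_cast pk.1.prop.one_lt.le)) (pow_nonneg (hr0 _) _)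
  · obtain ⟨p, k⟩ := pk
    have hlog : Real.log p ≤ (p : ℝ) ^ ε / ε := Real.log_le_rpow_div (hp0 p).le hεp
    have hpow : ((p : ℝ) ^ (-σ)) ^ (k + 2) = (p : ℝ) ^ (-(2 * σ)) * ((p : ℝ) ^ (-σ)) ^ k := by
      rw [pow_add, mul_comm, ← Real.rpow_natCast ((p : ℝ) ^ (-σ)) 2, ← Real.rpow_mul (hp0 p).le]
      norm_num
      left; ring
    have hexp : (p : ℝ) ^ ε / ε * (p : ℝ) ^ (-(2 * σ)) = ε⁻¹ * (p : ℝ) ^ (-(1 + ε)) := by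
      have hmul : (p : ℝ) ^ ε * (p : ℝ) ^ (-(2 * σ)) = (p : ℝ) ^ (-(1 + ε)) := by
        rw [← Real.rpow_add (hp0 p)]
        congr 1
        simp only [hε]
        ring
      calc (p : ℝ) ^ ε / ε * (p : ℝ) ^ (-(2 * σ)) = ε⁻¹ * ((p : ℝ) ^ ε * (p : ℝ) ^ (-(2 * σ))) := by ring
        _ = ε⁻¹ * (p : ℝ) ^ (-(1 + ε)) := by rw [hmul]
    calc Real.log p * ((p : ℝ) ^ (-σ)) ^ (k + 2)
        = Real.log p * (p : ℝ) ^ (-(2 * σ)) * ((p : ℝ) ^ (-σ)) ^ k := by rw [hpow]; ring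
      _ ≤ (p : ℝ) ^ ε / ε * (p : ℝ) ^ (-(2 * σ)) * ((p : ℝ) ^ (-σ)) ^ k := by
          gcongr
      _ = B (p, k) := by rw [hexp]

/-- **`Σ_{n not prime} Λ(n) n^{-σ} < ∞` for `σ > 1/2`** (only the prime powers `p^k`, `k ≥ 2`, contribute;
reindex by `Nat.Primes.prodNatEquiv` as in Mathlib's `summable_residueClass_non_primes_div`). [folklore] -/
theorem summable_vonMangoldt_nonprime_rpow {σ : ℝ} (hσ : 1 / 2 < σ) :
    Summable fun n : ℕ => (if n.Prime then 0 else Λ n) * (n : ℝ) ^ (-σ) := by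
  set F₀ : ℕ → ℝ := fun n => (if n.Prime then 0 else Λ n) * (n : ℝ) ^ (-σ) with hF₀
  -- only prime powers contribute
  have hzero : ∀ n : ℕ, ¬ IsPrimePow n → F₀ n = 0 := fun n hn => by
    simp only [hF₀, ArithmeticFunction.vonMangoldt_eq_zero_iff.mpr hn, ite_self, zero_mul]
  refine ((summable_subtype_iff_indicator (s := {n : ℕ | IsPrimePow n})).mp ?_).congr
    fun n => Set.indicator_apply_eq_self.mpr fun (hn : ¬ IsPrimePow n) => hzero n hn
  -- reindex by `(p, k) ↦ p^(k+1)`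
  set F' : Nat.Primes × ℕ → ℝ := fun pk => F₀ ((pk.1 : ℕ) ^ (pk.2 + 1)) with hF'
  have hFF' : F₀ ∘ Subtype.val (p := fun n => n ∈ {n : ℕ | IsPrimePow n}) =
      F' ∘ ⇑Nat.Primes.prodNatEquiv.symm := by
    refine (Equiv.eq_comp_symm Nat.Primes.prodNatEquiv (F₀ ∘ Subtype.val) F').mpr ?_
    ext1 ⟨p, k⟩
    rfl
  rw [hFF']
  refine (Nat.Primes.prodNatEquiv.symm.summable_iff (f := F')).mpr ?_
  -- `F' (p, 0) = 0`; shift `k ↦ k + 1`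
  have hF'0 : ∀ p : Nat.Primes, F' (p, 0) = 0 := fun p => by
    simp only [hF', hF₀, zero_add, pow_one, p.prop, if_true, zero_mul]
  have hshift : Summable (F' ∘ Prod.map _root_.id (· + 1)) := by
    refine (summable_log_mul_rpow_pow hσ).congr fun pk => ?_
    obtain ⟨p, k⟩ := pk
    have hp0 : (0 : ℝ) ≤ p := by exact_mod_cast p.prop.pos.le
    have hnp : ¬ ((p : ℕ) ^ (k + 2)).Prime := Nat.Prime.not_prime_pow (by omega)
    show Real.log p * ((p : ℝ) ^ (-σ)) ^ (k + 2) = F' (Prod.map _root_.id (· + 1) (p, k))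
    simp only [Prod.map_apply, id_eq, hF', hF₀]
    rw [add_assoc, one_add_one_eq_two, if_neg hnp, ArithmeticFunction.vonMangoldt_apply_pow (by omega : k + 2 ≠ 0),
      ArithmeticFunction.vonMangoldt_apply_prime p.prop, Nat.cast_pow]
    congr 1
    rw [← Real.rpow_natCast ((p : ℝ) ^ (-σ)) (k + 2), ← Real.rpow_mul hp0, ← Real.rpow_natCast (p : ℝ) (k + 2),
      ← Real.rpow_mul hp0]
    congr 1
    push_cast
    ring
  refine (Function.Injective.summable_iff ?_ fun u hu => ?_).mp hshift
  · exact Function.Injective.prodMap (fun ⦃a₁ a₂⦄ a => a) <| add_left_injective 1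
  · simp only [Set.range_prodMap, Set.range_id, Set.mem_prod, Set.mem_univ, Set.mem_range,
      Nat.exists_add_one_eq, true_and, not_lt, nonpos_iff_eq_zero] at hu
    rw [← hF'0 u.1, ← hu]

/-! ## From the prime deficit to the full one-sided series -/

/-- **Prime deficit ⟹ full one-sided deficit.** For `c ≥ 0` and `σ > 1/2`: if
`Σ_p (log p - c(p))₊ p^{-σ} < ∞` then `Σ_n (Λ(n) - c(n))₊ n^{-σ}` converges absolutely
(`(Λ - c)₊ = (log p - c(p))₊` at primes, `≤ Λ` at the other prime powers, `= 0` elsewhere;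
`summable_vonMangoldt_nonprime_rpow`). [folklore] -/
theorem lseriesSummable_posPart_of_prime_deficit {c : ℕ → ℝ} (hc : ∀ n, 0 ≤ c n) {σ : ℝ} (hσ : 1 / 2 < σ)
    (h : Summable fun p : ℕ => if p.Prime then max (Real.log p - c p) 0 / (p : ℝ) ^ σ else 0) :
    LSeriesSummable (fun n => ((max (Λ n - c n) 0 : ℝ) : ℂ)) σ := by
  have hB := summable_vonMangoldt_nonprime_rpow hσ
  have hA0 : ∀ n : ℕ, 0 ≤ (if n.Prime then max (Real.log n - c n) 0 / (n : ℝ) ^ σ else 0) := fun n => by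
    split_ifs <;> positivity
  have hB0 : ∀ n : ℕ, 0 ≤ (if n.Prime then 0 else Λ n) * (n : ℝ) ^ (-σ) := fun n => by
    refine mul_nonneg ?_ (Real.rpow_nonneg n.cast_nonneg _)
    split_ifs
    · exact le_rfl
    · exact ArithmeticFunction.vonMangoldt_nonneg
  refine Summable.of_norm (Summable.of_nonneg_of_le (fun n => norm_nonneg _) (fun n => ?_) (h.add hB))
  rcases eq_or_ne n 0 with rfl | hn
  · rw [LSeries.term_zero, norm_zero]
    exact add_nonneg (hA0 0) (hB0 0)
  have hn0 : (0 : ℝ) < n := by exact_mod_cast Nat.pos_of_ne_zero hn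
  rw [LSeries.norm_term_eq, if_neg hn, Complex.norm_real, Real.norm_of_nonneg (le_max_right _ _),
    ofReal_re]
  have hrpow : (n : ℝ) ^ (-σ) = 1 / (n : ℝ) ^ σ := by
    rw [Real.rpow_neg hn0.le, one_div]
  by_cases hp : n.Prime
  · rw [if_pos hp, if_pos hp, ArithmeticFunction.vonMangoldt_apply_prime hp, zero_mul, add_zero]
  · rw [if_neg hp, if_neg hp, zero_add, hrpow, mul_one_div]
    refine div_le_div_of_nonneg_right (max_le ?_ ArithmeticFunction.vonMangoldt_nonneg) (Real.rpow_nonneg hn0.le _)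
    linarith [hc n]

/-! ## The stub -/

/-- **Registered stub `stub_transfer` of the line `Sketch` (Landau transfer).** For `c ≥ 0` with
`Σ c(n) n^{-σ} < ∞` (`σ > 1`), local continuation of `L_c - 1/(s-1)` through every point of `Re s > 1/2`
(thin open rectangles reaching `Re s > 1`), and `Σ_p (log p - c(p))₊ p^{-σ} < ∞` for all `σ > 1/2`: RH.
Proof: `riemannHypothesis_of_fakeWeight_landau` (absolute convergence at `x₀ = 2`; for a height `γ` and
width `X` the stub's rectangle through `s₀ = max X 1 + iγ` contains `(1/2, X) × (γ - η, γ + η)`, on which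
`L_c = F + 1/(s-1)` for `Re s > 2 > 1`; the prime deficit gives the full one-sided series by
`lseriesSummable_posPart_of_prime_deficit`). [folklore] -/
theorem stub_transfer : ∀ c : ℕ → ℝ, (∀ n, 0 ≤ c n) → (∀ σ : ℝ, 1 < σ → LSeriesSummable (fun n => ((c n : ℝ) : ℂ)) σ) → (∀ s₀ : ℂ, 1 / 2 < s₀.re → ∃ η : ℝ, 0 < η ∧ ∃ F : ℂ → ℂ, DifferentiableOn ℂ F {s : ℂ | 1 / 2 < s.re ∧ s.re < s₀.re + 1 ∧ s₀.im - η < s.im ∧ s.im < s₀.im + η} ∧ ∀ s ∈ {s : ℂ | 1 / 2 < s.re ∧ s.re < s₀.re + 1 ∧ s₀.im - η < s.im ∧ s.im < s₀.im + η}, 1 < s.re → F s = LSeries (fun n => ((c n : ℝ) : ℂ)) s - 1 / (s - 1)) → (∀ σ : ℝ, 1 / 2 < σ → Summable (fun p : ℕ => if p.Prime then max (Real.log p - c p) 0 / (p : ℝ) ^ σ else 0)) → RiemannHypothesis := by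
  intro c hc hsum hcont hdef
  have hsum2 : LSeriesSummable (fun n => ((c n : ℝ) : ℂ)) ((2 : ℝ) : ℂ) := hsum 2 (by norm_num)
  refine riemannHypothesis_of_fakeWeight_landau hc hsum2 (fun γ X => ?_)
    (fun σ hσ => lseriesSummable_posPart_of_prime_deficit hc hσ (hdef σ hσ))
  set s₀ : ℂ := ((max X 1 : ℝ) : ℂ) + γ * I with hs₀
  have hs₀re : s₀.re = max X 1 := by simp [hs₀]
  have hs₀im : s₀.im = γ := by simp [hs₀]
  obtain ⟨η, hη, F, hF, hFeq⟩ := hcont s₀ (by rw [hs₀re]; exact lt_of_lt_of_le one_half_lt_one (le_max_right _ _))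
  have hsub : ({s : ℂ | 1 / 2 < s.re} ∩ {s : ℂ | s.re < X}) ∩ ({s : ℂ | s.im < γ + η} ∩ {s : ℂ | γ - η < s.im}) ⊆
      {s : ℂ | 1 / 2 < s.re ∧ s.re < s₀.re + 1 ∧ s₀.im - η < s.im ∧ s.im < s₀.im + η} := by
    rintro s ⟨⟨h1, h2⟩, h3, h4⟩
    have h2' : s.re < X := h2
    have h3' : s.im < γ + η := h3
    have h4' : γ - η < s.im := h4
    refine ⟨h1, ?_, ?_, ?_⟩
    · rw [hs₀re]; linarith [le_max_left X 1]
    · rw [hs₀im]; exact h4'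
    · rw [hs₀im]; exact h3'
  refine ⟨η, hη, F, hF.mono hsub, fun s hs hs2 hs1 => ?_⟩
  have h := hFeq s (hsub hs) (by linarith)
  rw [h, one_div, sub_add_cancel]

end Summit.RiemannHypothesis.RiemannHypothesis.Cruxes.ConeMagnification.Sketch

end
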